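import Literature.MathematicalPhysics.QuantumFieldTheory.Balaban1983to89.Beta.RemainderDecay190PeriodisedEnd

/-!
# [Balaban1987RG1] (4.4) p. 281 ∕ [Balaban1988RG2Cluster] p. 15 on the (4.4)-space MODEL: NODE B (the seam) DISSOLVED —
# the row-(D4) END from ACTIVITIES DEFINED ON THE MODEL SPACE, four periodised decaying pieces, the window and numerics
# (`Beta.RemainderDecay190ModelEnd`)

statement-level skeleton of published theorems with citation tags; proofs where landed; nothing here is a claim
about the Yang–Mills mass gap.

HONEST FRAMING (cell rule).  Bookkeeping for the k-uniform remainder chain of row (D4) (`RemainderConst` ⇐ ONE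
`ChainTFac190` instance, `Beta.RemainderDecay190`); discharges NOTHING of `BetaPertH`; NOT B12 Thm 2, NOT the continuum
limit, NOT Clay.  Unit `b2b-balaban-beta-an4` gen 96 (BINDER row D4 OWNER; cell pub-balaban).  Imports
`Beta.RemainderDecay190PeriodisedEnd` (this generation: the END with NODE D and NODE E fed by the pieces) ONLY; nothing
edited.  ONE COMPOSITION, no new idea.

WHAT.  `RemainderDecay190PeriodisedEnd.remainderConst_of_stepObjects_periodisedPieces` still quantifies over abstract
step objects `O k p n : StepObjectD4` (configurations `Φ`, analyticity domains `sp2 X`, activities `H`) and a SEAM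
`emb k p n X : (TPt d (N·M) → ℂ) → Φ` into the analyticity domains along which the activities are ℂ-differentiable
([I] (4.4) p. 281 — NODE B of the owner table).  ON THE MODEL the natural step object has `Φ :=` the model space itself,
`sp2 X :=` the α₂-ball, and the seam is the identity: **`remainderConst_of_modelActivities_periodisedPieces`** takes, per
(scale, history, torus), ACTIVITIES `act k p n Z : (TPt d (N·M) → ℂ) → ℂ` on the model space that are
ℂ-differentiable on the α₂-ball ([II] p. 15 *"analytic functions of (𝐔, 𝐉) on the space 𝐔ᶜ_{k+1}(X, α₀, α₁)"*) and obey
Lemma 3 (2.38) there, the window sites ∕ functionals with the (1.7)-factorization of the (2.13)-sum of the activities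
(`locE`, written out), the FOUR PERIODISED DECAYING PIECES with (182), the socket numerics and the (1.22) pin — and
concludes `RemainderConst S γ (ε₁ · K_rem,L(d, M, c, α₂, B₃(q)))`.  The step object is ASSEMBLED inside the proof
(`⟨model space, α₂-ball, act, ·⟩`; `hsp` trivial, `emb := id`, `hemb` trivial).  AFTER THIS FILE the object-level inputs of
row (D4) on the model carrier are: activities on the model space with holomorphy + (2.38) (NODE O.4 ∕ A), the window with
(1.7), four pieces + (182) (NODE O.2), numerics, the pin.  WHAT IS *NOT* DONE: Bałaban's activities live on 𝔘ᶜ_{k+1}(X,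
α₀, α₁) ⊂ (𝐔, 𝐉)-space, not on the model space — reading them on the model IS the seam, and nothing of it is constructed
here; (189) NOT discharged (inside the piece `a₀`'s decay); row D4 class UNCHANGED (instance 0∕1; critical-path width 0 =
NODE O; D4 DISCHARGE NO DATE).  No `def`, no named fact, no `sorry`, standard axioms.
HONEST DEPENDENCY: continuum YM on T⁴ ⇐ BetaPertH ∧ nine spine estimates (0/9 proved); BetaPertH ⇐ (D1) ∧ (D4) ∧
CAP+tail; G-an2-4 gates asym, D1 and NE2/3/4.

Sources: [I] = T. Bałaban, Commun. Math. Phys. **109** (1987) 249–301 [Balaban1987RG1], (1.7) p. 261, (1.22) p. 264, (4.4)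
p. 281, (5.10) p. 293; [II] = Commun. Math. Phys. **116** (1988) 1–22 [Balaban1988RG2Cluster], (2.13) p. 14, p. 15, (2.38)
p. 20; [15] = Commun. Math. Phys. **102** (1985) 277–309 [Balaban1985Variational], (182) p. 307, (190) p. 308.
-/

namespace Literature.MathematicalPhysics.QuantumFieldTheory.Balaban1983to89.Beta.RemainderDecay190ModelEnd

open Literature.MathematicalPhysics.QuantumFieldTheory.Balaban1983to89
open Literature.MathematicalPhysics.QuantumFieldTheory.Balaban1983to89.B13ScaleTransfer (Pt)
open Literature.MathematicalPhysics.QuantumFieldTheory.Balaban1983to89.B13Resummation (locE)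
open Literature.MathematicalPhysics.QuantumFieldTheory.Balaban1983to89.TreeLengthTorus (TPt TDom proj tsys)
open Literature.MathematicalPhysics.QuantumFieldTheory.Balaban1983to89.TreeLengthTorusGeometry (TTouch)
open Literature.MathematicalPhysics.QuantumFieldTheory.Balaban1983to89.B12Decay510 (mixedDeriv)
open Literature.MathematicalPhysics.QuantumFieldTheory.Balaban1983to89.B12Decay510Lattice (cubeOf)
open Literature.MathematicalPhysics.QuantumFieldTheory.Balaban1983to89.B12Decay510Window (K₁)
open Literature.MathematicalPhysics.QuantumFieldTheory.Balaban1983to89.B12Sec2to5 (l1)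
open Literature.MathematicalPhysics.QuantumFieldTheory.Balaban1983to89.B11SectG (Eq182)
open Literature.MathematicalPhysics.QuantumFieldTheory.Balaban1983to89.Beta.RemainderLimitTorus (LDom tproj limKernel)
open Literature.MathematicalPhysics.QuantumFieldTheory.Balaban1983to89.Beta.RemainderDecay190 (Consts190)
open Literature.MathematicalPhysics.QuantumFieldTheory.Balaban1983to89.Beta.RemainderChain (RemainderConst)
open Literature.MathematicalPhysics.QuantumFieldTheory.Balaban1983to89.Beta.RemainderChainLattice
  (CondsL SignsL remCoeffL)
open Literature.MathematicalPhysics.QuantumFieldTheory.Balaban1983to89.Beta.RemainderStepAdapterHolo (StepObjectD4)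
open Literature.MathematicalPhysics.QuantumFieldTheory.Balaban1983to89.Beta
  (Kernel₂ IsPeriodic₂ Decay₂ compKer periodise₂)
open Literature.MathematicalPhysics.QuantumFieldTheory.Balaban1983to89.Beta.RemainderLocalitySockets (restrictCLM)
open Literature.MathematicalPhysics.QuantumFieldTheory.Balaban1983to89.Beta.RemainderDecay190PeriodisedEnd
  (remainderConst_of_stepObjects_periodisedPieces)
open Metric Set Filter Topology

variable {d : ℕ} {M : ℕ} [NeZero M]

open Classical in
/-- **THE ROW-(D4) END ON THE MODEL CARRIER FROM ACTIVITIES ON THE MODEL SPACE — no seam, no letter about δ𝐇∕δB.**  Per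
(scale `k`, history `p`, torus `n`): activities `act k p n Z` on the sup-normed complex torus fields, ℂ-differentiable on
the α₂-ball (`hH`, [II] p. 15) with Lemma 3 (2.38) there (`h3`); window sites `e Y` (finite, distinct, inside the cubes of
`Y`) and window functionals `F k p Y` with the eventual (1.7)-factorization of the (2.13)-sum of the activities
(`hfac`, `locE` written out); FOUR ℤ^d pieces `a₀ h₀ h 𝔡` decaying at a common rate and block-periodic under every torus
period, four torus operator families acting entrywise as their periodisations, (182) for `dH`; the socket numerics; the
(1.22) pin against the written read-out; under N1–N3 ⟹ `RemainderConst S γ (ε₁ · K_rem,L(d, M, c, α₂, B₃(q)))`.  The step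
object `⟨model space, α₂-ball, act⟩` and the identity seam are assembled inside the proof and fed to
`RemainderDecay190PeriodisedEnd.remainderConst_of_stepObjects_periodisedPieces`.  Nothing of Bałaban's is asserted.
[cite: Balaban1987RG1, (1.22) p.264, (1.7) p.261, (4.4) p.281, (5.10) p.293; Balaban1988RG2Cluster, (2.13) p.14, p.15 and (2.38) p.20; Balaban1985Variational, (182) p.307 and (190) p.308] -/
theorem remainderConst_of_modelActivities_periodisedPieces {μ ν : Fin d} {β : FlowStep.HBeta}
    (S : B12Beta.OneLoopSplit β) {γ : ℝ} {c : B13.Consts} {ℓ α₂ : ℝ} {q : Consts190}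
    (hC : CondsL d c ℓ) (h22 : c.R22gen ℓ) (hq : q.Valid c.δ₀) (hs : SignsL c α₂ q.B₃)
    -- per (scale, history): the torus family; per torus: ACTIVITIES ON THE MODEL SPACE with (2.38) and holomorphy
    (N : (k : ℕ) → (Fin (k + 1) → ℝ) → ℕ → ℕ) (hN : ∀ k p n, NeZero (N k p n))
    (hNlim : ∀ k p, Tendsto (N k p) atTop atTop)
    (act : (k : ℕ) → (p : Fin (k + 1) → ℝ) → (n : ℕ) → TDom d (N k p n) → (TPt d (N k p n * M) → ℂ) → ℂ)
    (h3 : ∀ k p n (Z : TDom d (N k p n)), ∀ v ∈ ball (0 : TPt d (N k p n * M) → ℂ) α₂,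
      ‖act k p n Z v‖ ≤ c.C3act * c.ε₁ * Real.exp (-((1 - 8 * c.δ) * ℓ * c.κ * (tsys d (N k p n)).dj Z)))
    (hH : ∀ k p n (Z : TDom d (N k p n)), DifferentiableOn ℂ (act k p n Z) (ball 0 α₂))
    -- per (scale, history, torus): the four Sect. G operators and their (182)-composite
    (dH A0 H0 Hk Dfr : (k : ℕ) → (p : Fin (k + 1) → ℝ) → (n : ℕ) →
      (TPt d (N k p n * M) → ℝ) →ₗ[ℝ] (TPt d (N k p n * M) → ℝ))
    (h182 : ∀ k p n, Eq182 (dH k p n) (A0 k p n) (H0 k p n) (Hk k p n) (Dfr k p n))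
    -- the window: sites, functionals, (1.7)-factorization of the (2.13)-sum of the activities
    {ι : LDom d → Type} [∀ Y, Fintype (ι Y)] (e : (Y : LDom d) → ι Y → Pt d)
    (he : ∀ Y i, cubeOf M (e Y i) ∈ Y.1) (hinj : ∀ Y, Function.Injective (e Y))
    (F : (k : ℕ) → (p : Fin (k + 1) → ℝ) → (Y : LDom d) → (ι Y → ℂ) → ℂ)
    (hfac : ∀ k p (Y : LDom d), ∀ᶠ n in atTop, ∀ v ∈ ball (0 : TPt d (N k p n * M) → ℂ) α₂,
      locE (TTouch (d := d) (N := N k p n)) (fun Z : (tsys d (N k p n)).Dom => Z.1) (fun Z => act k p n Z v)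
          (tproj (N k p n) Y).1 = F k p Y (restrictCLM (N k p n * M) (e Y) v))
    -- per (scale, history): the four ℤ^d pieces, decaying at a common rate, periodic under every torus period
    (a₀ h₀ h 𝔡 : (k : ℕ) → (Fin (k + 1) → ℝ) → Kernel₂ d) (Ca Ch₀ Ch Cd δ₀ : (k : ℕ) → (Fin (k + 1) → ℝ) → ℝ)
    (ha : ∀ k p, Decay₂ (a₀ k p) (Ca k p) (δ₀ k p)) (hh₀ : ∀ k p, Decay₂ (h₀ k p) (Ch₀ k p) (δ₀ k p))
    (hh : ∀ k p, Decay₂ (h k p) (Ch k p) (δ₀ k p)) (hd : ∀ k p, Decay₂ (𝔡 k p) (Cd k p) (δ₀ k p))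
    (hδ₀ : ∀ k p, 0 < δ₀ k p)
    (pa : ∀ k p n, IsPeriodic₂ (N k p n * M) (a₀ k p)) (ph₀ : ∀ k p n, IsPeriodic₂ (N k p n * M) (h₀ k p))
    (ph : ∀ k p n, IsPeriodic₂ (N k p n * M) (h k p)) (pd : ∀ k p n, IsPeriodic₂ (N k p n * M) (𝔡 k p))
    (hA0 : ∀ k p n (a b : TPt d (N k p n * M)), A0 k p n (Pi.single b 1) a = periodise₂ (N k p n * M) (a₀ k p) a b)
    (hH0 : ∀ k p n (a b : TPt d (N k p n * M)), H0 k p n (Pi.single b 1) a = periodise₂ (N k p n * M) (h₀ k p) a b)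
    (hHk : ∀ k p n (a b : TPt d (N k p n * M)), Hk k p n (Pi.single b 1) a = periodise₂ (N k p n * M) (h k p) a b)
    (hDfr : ∀ k p n (a b : TPt d (N k p n * M)), Dfr k p n (Pi.single b 1) a = periodise₂ (N k p n * M) (𝔡 k p) a b)
    -- numerics of the (190)-socket on the cube torus (block-torus weights free)
    (η L Mg R : (k : ℕ) → (Fin (k + 1) → ℝ) → ℕ → ℝ) (Hw : (k : ℕ) → (Fin (k + 1) → ℝ) → ℕ → Prop) {δr : ℝ}
    (hδr : 0 < δr) (hσ₀ : 0 < q.σ) (hcR : B6.c0 δr (q.σ / δr) ^ d ≤ q.cR) (hκB : 1 ≤ q.κB)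
    (hδ15 : ∀ k p, q.δ15 ≤ δ₀ k p / 2)
    (hCst : ∀ k p, ((Ca k p + Ch₀ k p) + |(-1 : ℝ)| *
        (Ch k p * (Cd k p * (Ca k p + Ch₀ k p) * ∑' w : Fin d → ℤ, Real.exp (-(δ₀ k p - δ₀ k p / 2) * l1 w)) *
          ∑' w : Fin d → ℤ, Real.exp (-(δ₀ k p / 2 - δ₀ k p / 4) * l1 w))) *
        K₁ d (δ₀ k p / 8) * K₁ d (δ₀ k p / 16) ≤ q.Cst)
    (hm : 1 ≤ q.m) (hθ : 0 ≤ q.θ) (hθM : q.θ * M ≤ 1)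
    -- the (1.22) identification against the WRITTEN read-out
    (beta1_eq : ∀ k p, p ∈ B12Beta.HistBox γ k →
      S.β1 k p = B12Beta.secondMoment (fun _ _ => limKernel fun Y z =>
        (mixedDeriv (F k p Y)
          (fun i => (((a₀ k p + h₀ k p) + fun x y =>
            (-1) * compKer (h k p) (compKer (𝔡 k p) (a₀ k p + h₀ k p)) x y) (e Y i) 0 : ℂ))
          (fun i => (((a₀ k p + h₀ k p) + fun x y =>
            (-1) * compKer (h k p) (compKer (𝔡 k p) (a₀ k p + h₀ k p)) x y) (e Y i) z : ℂ))).re) μ ν) :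
    RemainderConst S γ (c.ε₁ * remCoeffL d M c α₂ q.B₃) := by
  -- the model step object: configurations = the model space, analyticity domains = the α₂-ball, activities = `act`
  let O : (k : ℕ) → (p : Fin (k + 1) → ℝ) → (n : ℕ) → StepObjectD4 d (N k p n) := fun k p n =>
    haveI := hN k p n
    { Φ := TPt d (N k p n * M) → ℂ, sp2 := fun _ => ball 0 α₂, H := act k p n, hsp := fun _ _ _ _ hφ => hφ }
  have hO3 : ∀ k p n, (O k p n).Lemma3OnH c ℓ := fun k p n Z φ hφ => h3 k p n Z φ hφ
  have hE : ∀ k p n (X : TDom d (N k p n)) (v : TPt d (N k p n * M) → ℂ), (O k p n).E X v =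
      locE (TTouch (d := d) (N := N k p n)) (fun Z : (tsys d (N k p n)).Dom => Z.1) (fun Z => act k p n Z v) X.1 :=
    fun _ _ _ _ _ => rfl
  have hfac' : ∀ k p (Y : LDom d), ∀ᶠ n in atTop, ∀ v ∈ ball (0 : TPt d (N k p n * M) → ℂ) α₂,
      (O k p n).E (tproj (N k p n) Y) ((fun w : TPt d (N k p n * M) → ℂ => w) v) =
        F k p Y (restrictCLM (N k p n * M) (e Y) v) :=
    fun k p Y => (hfac k p Y).mono fun n hn v hv => by rw [hE]; exact hn v hv
  exact remainderConst_of_stepObjects_periodisedPieces S hC h22 hq hs N hN hNlim O hO3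
    (fun k p n _ v => v) (fun k p n _ v hv => hv) (fun k p n _ Z _ => hH k p n Z)
    dH A0 H0 Hk Dfr h182 e he hinj F hfac'
    a₀ h₀ h 𝔡 Ca Ch₀ Ch Cd δ₀ ha hh₀ hh hd hδ₀ pa ph₀ ph pd hA0 hH0 hHk hDfr η L Mg R Hw hδr hσ₀ hcR hκB hδ15 hCst hm hθ
    hθM beta1_eq

end Literature.MathematicalPhysics.QuantumFieldTheory.Balaban1983to89.Beta.RemainderDecay190ModelEnd
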